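import Literature.AlgebraicGeometry.HodgeTheory.RibetTypeOnePowersHodgeClasses
import Literature.AlgebraicGeometry.Motives.HodgeThetaSubalgebraUnitaryTwoTwo
import Literature.RepresentationTheory.ClassicalInvariants.MixedTensorLieInvariantsSL
import HarnessLib

/-!
# Hodge classes on abelian varieties with slots over an abelian FOURFOLD of unitary type `(2,2)` are `SU`-type invariants: the invariance theorem (Moonen–Zarhin 1995 type IV(1,1) «`Hg = SU(V,ψ)`»; van Geemen 1994 Thm. 6.11–6.12, Lie step)

Family `hodge`, layer `Literature/AlgebraicGeometry/HodgeTheory`. Research context: cell `pub-hodge-ring2` (HONEST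
FRAMING: research route conditional on HC_CM; not a corollary; Q11.4-sentence-2 already refuted in dim ≥ 3),
Literature lane (lit gen 68), heir item (H1), sub-row «type IV(1,1), signature (2,2)» of Moonen–Zarhin's fourfold
table. UNCONDITIONAL for the class of abelian varieties it names; ONE theorem, no definition, no named fact (D-0026),
no `sorry`. This file is the `(2,2)` twin of the INVARIANCE THEOREM of `RibetTypeTwoThreePowersHodgeClasses` (type
`(2,3)`) and `RibetTypeOnePowersHodgeClasses` (type `(m,1)`): the same text with THEOREM L for `𝔰𝔲`
(`UnitaryThetaTwoTwo.wordDerAt_eq_zero_of_commute_of_skew` of `Motives/HodgeThetaSubalgebraUnitaryTwoTwo`, resting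
on the classification-free matrix core `Motives/HodgeThetaSubalgebraUnitaryTwoTwoCore`) in place of THEOREM L″, the
multiplicity hypothesis `dim W^{1,0} = dim W^{0,1} = 2`, and — the one new feature at `n' = n''` — invariance only
under the TRACELESS typed differentials: `X ∈ 𝔰𝔩_{n₀}(ℂ)` acting by `X` on the `W`-letters and by `−Xᵀ` on the
`W'`-letters has `tr(φ_ℂ Y) = 2μ·tr X`, and THEOREM L for `𝔰𝔲` needs `tr(φ_ℂ Y) = 0`. (For `n' ≠ n''` coprime the
slices are killed by all of `𝔤𝔩_{n₀}(ℂ)` and the tensor FFT for `GL` yields divisor classes; at `(2,2)` the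
invariant theory is that of `SL₄ = SU(2,2)_ℂ`, whose extra invariants — determinants — are the Weil classes:
van Geemen Thm. 6.12, the tree's named fact `VanGeemen1994_thm612`; that assembly is NOT in this file.)

THE PRINT. Moonen–Zarhin, Math. Ann. 315 (1999) §2 (2.5) (2) (held `paper:arxiv-math_9901113` p. 5): «For g = 4 we
find cases where in addition to divisor classes we also need Weil classes to generate the Hodge ring. This happens if
End⁰(X) contains an imaginary quadratic field k which acts on the tangent space with multiplicities (2,2) … it can
occur only for X of Type 4(1,1) or of Type 4(4,1)»; Moonen–Zarhin, Duke Math. J. 77 (1995) (simple abelian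
fourfolds of type IV(1,1) with `End⁰ = k` of signature `(2,2)`: `Hg = SU(V,ψ)`, Hodge ring generated by divisors and
Weil classes; cite-only); van Geemen, LNM 1594 (1994) Lemma 6.10, Thm. 6.11 («`MT(X) ⊆ SU(H,T)`, equality in
general») and Thm. 6.12 (the `SU`-invariants).

PROVED HERE: **`AVSlots.exists_unitaryInvariant_coeff_twoTwo`** — for an abelian variety `B` with slots `g` over an
abelian variety `A` whose `H¹` carries `φ` with `φ² = −d`, `End_Hdg = ℚ + ℚφ` and multiplicities `(2,2)` on
`W = ker(φ_ℂ − μ)`, every rational `(p,p)`-class on `B` is `∑_w a(w)·(g e, g f)_w` for a coefficient function `a` on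
slot-and-type words whose slices are killed by the typed differential of EVERY TRACELESS `X ∈ 𝔰𝔩_{n₀}(ℂ)`;
§2 **`AVSlots.exists_slInvariant_coeff_twoTwo`** — the GROUP form: the slices are fixed by the typed Kronecker action
(`M` on the `W`-letters, `(M⁻¹)ᵀ` on the `W'`-letters) of every `M ∈ SL_{n₀}(ℂ)` (the tree's
`ClassicalInvariants.MixedTensorLieInvariantsSL`, Goodman–Wallach Thm. 2.2.2 / 2.2.7 (2)) — the hypothesis a tensor
first fundamental theorem for `SL` consumes.

## References
* [MoonenZarhin1999LowDim] B. Moonen, Yu. Zarhin, Math. Ann. 315 (1999), §2 (2.5) (2).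
* [MoonenZarhin1995Duke] B. Moonen, Yu. Zarhin, Duke Math. J. 77 (1995) 553–581, main theorem (type IV(1,1), (2,2)).
* [vanGeemen1994HodgeAV] B. van Geemen, LNM 1594 (1994), Lemma 6.10, Thm. 6.11, Thm. 6.12.
* [Ribet1983] K. A. Ribet, Amer. J. Math. 105 (1983), Thm. 3 (the coprime case this extends).
* [Gordon1997] B. B. Gordon, *A survey of the Hodge conjecture for abelian varieties*, §6 (pp. 18–19).
* [Deligne1982HodgeCycles] P. Deligne, LNM 900 (1982), I §3.
-/

noncomputable section

open scoped TensorProduct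
open scoped Matrix
open CategoryTheory Module

namespace Literature.AlgebraicGeometry.HodgeTheory

open Literature.AlgebraicTopology.SingularHomology
open Literature.AlgebraicGeometry.Motives (IsSmoothProjective AbelianVariety bettiCohomology
  ofRatClassBaseChange ofRatClassBaseChange_tmul HodgeTensorFacts hodgeTensorFacts_holds)
open Literature.Barriers.HodgeConjecture
open Literature.AlgebraicGeometry.Motives.HodgeStructure
open Literature.RepresentationTheory.GeneralLinear
open Literature.RepresentationTheory.ClassicalInvariants
open Literature.NumberTheory.DiophantineGeometry
open Literature.AlgebraicGeometry.ComplexMultiplication (bettiRep_of)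

section Invariance

variable {A B : AbelianVariety ℂ} {n : ℕ} {g : Fin n → (B ⟶ A)}

/-- The two elements of `Fin 2`. [folklore] -/
private theorem fin2_cases' (r : Fin 2) : r = 0 ∨ r = 1 := by
  fin_cases r <;> simp

open scoped Classical in
/-- **THE INVARIANCE THEOREM at multiplicities `(2,2)`** (Lie step of «the Hodge ring of an abelian fourfold of
type IV(1,1) with `End⁰ = k` of signature `(2,2)` — and of the abelian varieties with slots over it — consists of
`SU(V,ψ)`-invariants»; Moonen–Zarhin 1995, van Geemen Thm. 6.11–6.12) — verbatim the tree's
`AVSlots.exists_unitaryInvariant_coeff_twoThree` with THEOREM L for `𝔰𝔲`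
(`UnitaryThetaTwoTwo.wordDerAt_eq_zero_of_commute_of_skew`) in place of THEOREM L″: every rational `(p,p)`-class on
`B` is `∑_w a(w)·(g e, g f)_w` for a coefficient function `a` on slot-and-type words whose slices are killed by the
typed differential of EVERY TRACELESS `X ∈ 𝔰𝔩_{n₀}(ℂ)` (`X` on the `W`-letters, `−Xᵀ` on the `W'`-letters; the
trace condition is forced: `tr(φ_ℂ Y) = 2μ·tr X`). [cite: MoonenZarhin1995Duke, main theorem (type IV(1,1), (2,2))]
[cite: MoonenZarhin1999LowDim, §2 (2.5) (2)] [cite: vanGeemen1994HodgeAV, Thm. 6.11 and Thm. 6.12]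
[cite: Gordon1997, §6 (proof of Thm. 6.3.3, pp. 18–19)] -/
theorem AVSlots.exists_unitaryInvariant_coeff_twoTwo [HodgeTensorFacts.{0, 0}] (hg : AVSlots A B g)
    (hHD : exists_isReal_hodgeModel) (hI : hodgePQ_independent_of_hodgeModel)
    (ψ : (BettiUniverse.hodge hHD (AbelianVariety.isSmoothProjective_holds (A := A)) 1).Polarization)
    {φ : Module.End ℚ (bettiCohomology A.X 1)}
    (hφE : φ ∈ (BettiUniverse.hodge hHD (AbelianVariety.isSmoothProjective_holds (A := A)) 1).endAlg)
    {d : ℚ} (hd : 0 < d) (hφ2 : φ * φ = -(d • 1))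
    (hE : ∀ a ∈ (BettiUniverse.hodge hHD (AbelianVariety.isSmoothProjective_holds (A := A)) 1).endAlg,
      ∃ x y : ℚ, a = x • 1 + y • φ)
    {μ : ℂ} (hμ : μ ^ 2 = -(d : ℂ))
    (h22 : Module.finrank ℂ ↥(Module.End.eigenspace (φ.baseChange ℂ) μ ⊓
        (BettiUniverse.hodge hHD (AbelianVariety.isSmoothProjective_holds (A := A)) 1).piece 1 0) = 2 ∧
      Module.finrank ℂ ↥(Module.End.eigenspace (φ.baseChange ℂ) μ ⊓
        (BettiUniverse.hodge hHD (AbelianVariety.isSmoothProjective_holds (A := A)) 1).piece 0 1) = 2)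
    {n₀ : ℕ} (cb : Module.Basis (Fin 2 × Fin n₀) ℂ (ℂ ⊗[ℚ] bettiCohomology A.X 1)) (κ : Fin n₀ → Fin 2)
    (hcbW : ∀ ℓ, cb (0, ℓ) ∈ Module.End.eigenspace (φ.baseChange ℂ) μ)
    (hcbW' : ∀ ℓ, cb (1, ℓ) ∈ Module.End.eigenspace (φ.baseChange ℂ) (-μ))
    (hcb0 : ∀ ℓ, κ ℓ = 0 →
      cb (0, ℓ) ∈ (BettiUniverse.hodge hHD (AbelianVariety.isSmoothProjective_holds (A := A)) 1).piece 1 0 ∧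
      cb (1, ℓ) ∈ (BettiUniverse.hodge hHD (AbelianVariety.isSmoothProjective_holds (A := A)) 1).piece 0 1)
    (hcb1 : ∀ ℓ, κ ℓ = 1 →
      cb (0, ℓ) ∈ (BettiUniverse.hodge hHD (AbelianVariety.isSmoothProjective_holds (A := A)) 1).piece 0 1 ∧
      cb (1, ℓ) ∈ (BettiUniverse.hodge hHD (AbelianVariety.isSmoothProjective_holds (A := A)) 1).piece 1 0)
    (hdual : ∀ i j, ψ.form.baseChange ℂ (cb (0, i)) (cb (1, j)) = if i = j then 1 else 0)
    {p : ℕ} (hp : 0 < p) {c : complexBetti B.X (2 * p)} (hcQ : IsRationalClass c)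
    (hc : IsOfHodgeType B.dim B.X (2 * p) p p c) :
    ∃ a : (Fin (2 * p) → (Fin n × Fin 2) × Fin n₀) → ℂ,
      wordEval (cupPowOneAlt ℂ (Motives.ComplexPoints B.X) (2 * p))
        (fun x : (Fin n × Fin 2) × Fin n₀ => avLetters g (fun tl : Fin 2 × Fin n₀ =>
          ofRatClassBaseChange (Motives.ComplexPoints A.X) 1 (cb tl)) (x.1.1, (x.1.2, x.2))) a = c ∧
      ∀ (U : Fin (2 * p) → Fin n × Fin 2) (X : Matrix (Fin n₀) (Fin n₀) ℂ), X.trace = 0 →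
        wordDerAt ℂ (fun t => if (U t).2 = 0 then X else -Xᵀ) (wordSlice a U) = 0 := by
  classical
  -- the setting
  have hX : IsSmoothProjective A.dim A.X := AbelianVariety.isSmoothProjective_holds
  haveI : Module.Finite ℚ (bettiCohomology A.X 1) := finite_bettiCohomology_one A
  have hn1 : (((1 : ℕ) : ℤ)) = 1 := Nat.cast_one
  have heff := BettiUniverse.hodge_isEffective hHD hX 1
  obtain ⟨hμ0, -⟩ := UnitaryTheta.conj_eq_neg_of_sq hd hμ
  set F := cupPowOneAlt ℂ (Motives.ComplexPoints B.X) (2 * p) with hFdef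
  have hFinj : Function.Injective (exteriorPower.alternatingMapLinearEquiv F) :=
    injective_alternatingMapLinearEquiv_cupPowOneAlt B (2 * p)
  -- bases: the adapted basis `cbσ` and the rational basis `eC`, both indexed by `Fin M`
  set eQ := Module.finBasis ℚ (bettiCohomology A.X 1) with heQ
  set eC : Module.Basis (Fin (Module.finrank ℚ (bettiCohomology A.X 1))) ℂ
    (ℂ ⊗[ℚ] bettiCohomology A.X 1) := Algebra.TensorProduct.basis ℂ eQ with heC
  set φι : Fin (Module.finrank ℚ (bettiCohomology A.X 1)) ≃ Fin 2 × Fin n₀ := eC.indexEquiv cb with hφι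
  set cbσ : Module.Basis (Fin (Module.finrank ℚ (bettiCohomology A.X 1))) ℂ
    (ℂ ⊗[ℚ] bettiCohomology A.X 1) := cb.reindex φι.symm with hcbσdef
  have hcbσ : ∀ m, cbσ m = cb (φι m) := fun m => by
    rw [hcbσdef, Module.Basis.reindex_apply, Equiv.symm_symm]
  -- kinds of the adapted letters
  set κ2 : Fin 2 × Fin n₀ → Fin 2 := fun tl => if tl.1 = 0 then κ tl.2 else (if κ tl.2 = 0 then 1 else 0)
    with hκ2
  have hkind : ∀ tl : Fin 2 × Fin n₀,
      (κ2 tl = 0 → cb tl ∈ (BettiUniverse.hodge hHD (AbelianVariety.isSmoothProjective_holds (A := A)) 1).piece 1 0) ∧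
      (κ2 tl = 1 → cb tl ∈ (BettiUniverse.hodge hHD (AbelianVariety.isSmoothProjective_holds (A := A)) 1).piece 0 1) := by
    rintro ⟨t, ℓ⟩
    rcases fin2_cases' t with rfl | rfl <;> rcases fin2_cases' (κ ℓ) with h | h
    · have hk : κ2 (0, ℓ) = 0 := by simp [hκ2, h]
      rw [hk]
      exact ⟨fun _ => (hcb0 ℓ h).1, fun h' => absurd h' (by decide)⟩
    · have hk : κ2 (0, ℓ) = 1 := by simp [hκ2, h]
      rw [hk]
      exact ⟨fun h' => absurd h' (by decide), fun _ => (hcb1 ℓ h).1⟩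
    · have hk : κ2 (1, ℓ) = 1 := by simp [hκ2, h]
      rw [hk]
      exact ⟨fun h' => absurd h' (by decide), fun _ => (hcb0 ℓ h).2⟩
    · have hk : κ2 (1, ℓ) = 0 := by simp [hκ2, h]
      rw [hk]
      exact ⟨fun _ => (hcb1 ℓ h).2, fun h' => absurd h' (by decide)⟩
  set κ' : Fin (Module.finrank ℚ (bettiCohomology A.X 1)) → Fin 2 := fun m => κ2 (φι m) with hκ'
  -- letters
  set ρ := ofRatClassBaseChangeEquiv hX 1 with hρ
  set v : Module.Basis _ ℂ (complexBetti A.X 1) := cbσ.map ρ with hv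
  set eL : Module.Basis _ ℂ (complexBetti A.X 1) := eC.map ρ with heL
  have heLQ : ∀ i, IsRationalClass (eL i) := fun i => by
    rw [heL, Module.Basis.map_apply, heC, Algebra.TensorProduct.basis_apply, hρ,
      ofRatClassBaseChangeEquiv_apply, ofRatClassBaseChange_tmul, one_smul]
    exact isRationalClass_ofRatClass _
  have hv_apply : ∀ m, v m = ofRatClassBaseChange (Motives.ComplexPoints A.X) 1 (cb (φι m)) := fun m => by
    rw [hv, Module.Basis.map_apply, hcbσ, hρ, ofRatClassBaseChangeEquiv_apply]
  have hv0 : ∀ m, κ' m = 0 → IsOfHodgeType A.dim A.X 1 1 0 (v m) := by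
    intro m hm
    rw [hv_apply, ← BettiUniverse.mem_hodge_piece_iff hHD hI hX (k := 1) (p := 1) (q := 0) rfl]
    exact (hkind (φι m)).1 hm
  have hv1 : ∀ m, κ' m = 1 → IsOfHodgeType A.dim A.X 1 0 1 (v m) := by
    intro m hm
    rw [hv_apply, ← BettiUniverse.mem_hodge_piece_iff hHD hI hX (k := 1) (p := 0) (q := 1) rfl]
    exact (hkind (φι m)).2 hm
  -- (α) an antisymmetric kind-balanced coefficient function in the adapted letters
  obtain ⟨ax, hax_bal, hax_anti, hcax⟩ := hg.exists_antisymm_kindBalanced_wordEval_eq v κ' hv0 hv1 hp hc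
  -- the change of letters to the rational letters
  set G : Matrix _ _ ℂ := eC.toMatrix cbσ with hG
  set G' : Matrix _ _ ℂ := cbσ.toMatrix eC with hG'
  have hG'G : G' * G = 1 := cbσ.toMatrix_mul_toMatrix_flip eC
  have hve : ∀ m, v m = ∑ i, G i m • eL i := fun m => by
    simp only [hv, heL, Module.Basis.map_apply, ← map_smul, ← map_sum]
    congr 1
    exact (eC.sum_toMatrix_smul_self (v := ⇑cbσ) (j := m)).symm
  have hletters : ∀ j m, avLetters g v (j, m) = ∑ i, G i m • avLetters g eL (j, i) :=
    avLetters_baseChange g G hve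
  set aE := colourChangeAt (fun _ : Fin n => G) ax with haE
  have haE_anti : IsAntisymm aE := hax_anti.colourChangeAt _
  have hcaE : wordEval F (avLetters g eL) aE = c := by
    rw [haE, ← wordEval_eq_wordEval_colourChangeAt F (fun _ : Fin n => G) hletters ax, hcax]
  -- rationality of `aE`
  obtain ⟨q, hq⟩ := hg.exists_rat_wordEval_eq eL heLQ hcQ
  obtain ⟨q', -, haEq⟩ := haE_anti.exists_eq_algebraMap_of_wordEval_eq hFinj (hg.letterBasis eL)
    (q := q) (by rw [AVSlots.coe_letterBasis, hcaE, hFdef, hq])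
  have hslice_e : ∀ u, wordSlice aE u = wordRepAt ℂ (fun _ : Fin (2 * p) => G) (wordSlice ax u) :=
    fun u => wordSlice_colourChangeAt (fun _ : Fin n => G) ax u
  -- the Hodge operator `Θ`: `diag(±1)` in the adapted letters
  obtain ⟨Θ, hΘ⟩ := exists_hodgeTheta (BettiUniverse.hodge hHD (AbelianVariety.isSmoothProjective_holds (A := A)) 1)
  obtain ⟨-, -, hΘ10, hΘ01, -⟩ :=
    UnitaryTheta.theta_facts (BettiUniverse.hodge hHD (AbelianVariety.isSmoothProjective_holds (A := A)) 1)
      hn1 heff hΘ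
  have hΘb : ∀ m, Θ (cbσ m) = (if κ' m = 0 then (1 : ℂ) else -1) • cbσ m := by
    intro m
    rw [hcbσ]
    rcases fin2_cases' (κ' m) with h0 | h1'
    · rw [h0, if_pos rfl, one_smul]
      exact hΘ10 _ ((hkind (φι m)).1 h0)
    · rw [h1', if_neg one_ne_zero, neg_one_smul]
      exact hΘ01 _ ((hkind (φι m)).2 h1')
  have hΘcb : LinearMap.toMatrix cbσ cbσ Θ = kindDiag κ' := by
    ext i m
    rw [LinearMap.toMatrix_apply, hΘb, map_smul, Module.Basis.repr_self, Finsupp.smul_apply,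
      Finsupp.single_apply, kindDiag, Matrix.diagonal_apply, smul_eq_mul, mul_ite, mul_one, mul_zero]
    by_cases him : i = m
    · subst him; rw [if_pos rfl]
    · rw [if_neg (Ne.symm him), if_neg him]
  have hJG : LinearMap.toMatrix eC eC Θ * G = G * kindDiag κ' := by
    rw [← hΘcb, hG, linearMap_toMatrix_mul_basis_toMatrix, basis_toMatrix_mul_linearMap_toMatrix]
  have hΘq : ∀ u : Fin (2 * p) → Fin n, wordDerAt ℂ (fun _ : Fin (2 * p) => LinearMap.toMatrix eC eC Θ)
      (wordSlice (fun w => algebraMap ℚ ℂ (q' w)) u) = 0 := by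
    intro u
    rw [← haEq, hslice_e]
    refine wordDerAt_wordRepAt_eq_zero_of_mul_eq ℂ (fun _ : Fin (2 * p) => G) (fun _ => hJG) ?_
    rw [wordDerAt_const]
    exact wordDer_kindDiag_wordSlice_eq_zero κ' hax_bal u
  -- structure of the adapted basis for `ψ_ℂ` and `φ_ℂ`
  set ψC := ψ.form.baseChange ℂ with hψC
  have hφskewC : ∀ x y, ψC (φ.baseChange ℂ x) y + ψC x (φ.baseChange ℂ y) = 0 := by
    haveI : Nontrivial (bettiCohomology A.X 1) := by
      by_contra hV
      rw [not_nontrivial_iff_subsingleton] at hV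
      haveI : Subsingleton (ℂ ⊗[ℚ] bettiCohomology A.X 1) := by
        refine ⟨fun x y => ?_⟩
        have h : ∀ z : ℂ ⊗[ℚ] bettiCohomology A.X 1, z = 0 := fun z => by
          induction z using TensorProduct.induction_on with
          | zero => rfl
          | tmul c' v' => rw [Subsingleton.elim v' 0, TensorProduct.tmul_zero]
          | add a' b' ha hb => rw [ha, hb, add_zero]
        rw [h x, h y]
      have h0 : Module.finrank ℂ ↥(Module.End.eigenspace (φ.baseChange ℂ) μ ⊓
          (BettiUniverse.hodge hHD (AbelianVariety.isSmoothProjective_holds (A := A)) 1).piece 0 1) = 0 :=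
        Module.finrank_zero_of_subsingleton
      omega
    exact ThetaSubalgebra.formBaseChange_add_eq_zero_of_skew ψ
      (UnitaryTheta.form_apply_add_form_apply_eq_zero _ ψ hφE hd hφ2 hE)
  have hiso0 : ∀ i j, ψC (cb (0, i)) (cb (0, j)) = 0 := fun i j =>
    UnitaryTheta.form_eq_zero_of_mem_eigenspace hφskewC hμ0 (hcbW i) (hcbW j)
  have hiso1 : ∀ i j, ψC (cb (1, i)) (cb (1, j)) = 0 := fun i j =>
    UnitaryTheta.form_eq_zero_of_mem_eigenspace hφskewC (neg_ne_zero.2 hμ0) (hcbW' i) (hcbW' j)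
  have hswap10 : ∀ i j, ψC (cb (1, i)) (cb (0, j)) = -(if j = i then 1 else 0) := fun i j => by
    rw [hψC, ψ.form_baseChange_swap, show (((1 : ℕ) : ℤ)).negOnePow = -1 from Int.negOnePow_one, ← hψC, hdual]
    split_ifs <;> simp
  have hφcb : ∀ t ℓ, φ.baseChange ℂ (cb (t, ℓ)) = (if t = 0 then μ else -μ) • cb (t, ℓ) := by
    intro t ℓ
    rcases fin2_cases' t with rfl | rfl
    · rw [if_pos rfl]; exact Module.End.mem_eigenspace_iff.1 (hcbW ℓ)
    · rw [if_neg one_ne_zero]; exact Module.End.mem_eigenspace_iff.1 (hcbW' ℓ)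
  -- the invariance of every slice under the typed differentials, via THEOREM L′
  have key : ∀ X : Matrix (Fin n₀) (Fin n₀) ℂ, X.trace = 0 → ∀ u : Fin (2 * p) → Fin n,
      wordDerAt ℂ (fun _ : Fin (2 * p) => blockLiftGen φι (fun t : Fin 2 => if t = 0 then X else -Xᵀ))
        (wordSlice ax u) = 0 := by
    intro X hXtr u
    set Nf : Fin 2 → Matrix (Fin n₀) (Fin n₀) ℂ := fun t => if t = 0 then X else -Xᵀ with hNf
    have hNf0 : Nf 0 = X := if_pos rfl
    have hNf1 : Nf 1 = -Xᵀ := if_neg one_ne_zero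
    set Y := Matrix.toLin cbσ cbσ (blockLiftGen φι Nf) with hYdef
    have hYcb : ∀ t ℓ, Y (cb (t, ℓ)) = ∑ r, Nf t r ℓ • cb (t, r) :=
      fun t ℓ => toLin_blockLiftGen_apply φι cbσ (⇑cb) hcbσ Nf t ℓ
    have hYφ : Y * φ.baseChange ℂ = φ.baseChange ℂ * Y := by
      refine cb.ext fun tl => ?_
      obtain ⟨t, ℓ⟩ := tl
      rw [Module.End.mul_apply, Module.End.mul_apply, hφcb, map_smul, hYcb, map_sum, Finset.smul_sum]
      exact Finset.sum_congr rfl fun r _ => by rw [map_smul, hφcb, smul_comm]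
    have hYskew : ∀ x y, ψC (Y x) y + ψC x (Y y) = 0 := by
      have hB : ψC ∘ₗ Y + ψC.compl₂ Y = 0 := by
        refine LinearMap.BilinForm.ext_basis cb fun tk tl => ?_
        obtain ⟨t, k⟩ := tk
        obtain ⟨t', ℓ⟩ := tl
        rw [LinearMap.add_apply, LinearMap.add_apply, LinearMap.comp_apply, LinearMap.compl₂_apply,
          LinearMap.zero_apply, LinearMap.zero_apply, hYcb, hYcb, map_sum, LinearMap.sum_apply, map_sum]
        simp only [map_smul, LinearMap.smul_apply, smul_eq_mul]
        rcases fin2_cases' t with rfl | rfl <;> rcases fin2_cases' t' with rfl | rfl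
        · simp [hiso0]
        · simp [hNf0, hNf1, hdual, Matrix.neg_apply, Matrix.transpose_apply, mul_ite, Finset.sum_ite_eq,
            Finset.sum_ite_eq']
        · simp [hNf0, hNf1, hswap10, Matrix.neg_apply, Matrix.transpose_apply, mul_ite, Finset.sum_ite_eq,
            Finset.sum_ite_eq']
        · simp [hiso1]
      intro x y
      have h := LinearMap.congr_fun (LinearMap.congr_fun hB x) y
      simpa only [LinearMap.add_apply, LinearMap.comp_apply, LinearMap.compl₂_apply, LinearMap.zero_apply]
        using h
    -- the `K`-trace of `Y`: `tr(φ_ℂ Y) = μ·tr X + (−μ)·tr(−Xᵀ) = 2μ·tr X = 0`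
    have hYsu : LinearMap.trace ℂ (ℂ ⊗[ℚ] bettiCohomology A.X 1) (φ.baseChange ℂ * Y) = 0 := by
      have hterm : ∀ t ℓ, cb.repr (φ.baseChange ℂ (Y (cb (t, ℓ)))) (t, ℓ) =
          (if t = 0 then μ else -μ) * Nf t ℓ ℓ := by
        intro t ℓ
        rw [hYcb, map_sum, map_sum, Finset.sum_apply']
        simp_rw [map_smul, hφcb, map_smul, Module.Basis.repr_self, Finsupp.smul_apply, Finsupp.single_apply]
        simp [Finset.sum_ite_eq', mul_comm]
      have htrX : ∑ ℓ : Fin n₀, X ℓ ℓ = 0 := hXtr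
      have hs0 : ∑ ℓ : Fin n₀, cb.repr (φ.baseChange ℂ (Y (cb ((0 : Fin 2), ℓ)))) ((0 : Fin 2), ℓ) =
          μ * ∑ ℓ : Fin n₀, X ℓ ℓ := by
        rw [Finset.mul_sum]
        exact Finset.sum_congr rfl fun ℓ _ => by rw [hterm, if_pos rfl, hNf0]
      have hs1 : ∑ ℓ : Fin n₀, cb.repr (φ.baseChange ℂ (Y (cb ((1 : Fin 2), ℓ)))) ((1 : Fin 2), ℓ) =
          μ * ∑ ℓ : Fin n₀, X ℓ ℓ := by
        rw [Finset.mul_sum]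
        exact Finset.sum_congr rfl fun ℓ _ => by
          rw [hterm, if_neg one_ne_zero, hNf1, Matrix.neg_apply, Matrix.transpose_apply, neg_mul_neg]
      rw [LinearMap.trace_eq_matrix_trace ℂ cb, Matrix.trace]
      simp only [Matrix.diag_apply, LinearMap.toMatrix_apply, Module.End.mul_apply]
      rw [Fintype.sum_prod_type, Fin.sum_univ_two, hs0, hs1, htrX, mul_zero, add_zero]
    have hL := UnitaryThetaTwoTwo.wordDerAt_eq_zero_of_commute_of_skew
      (BettiUniverse.hodge hHD (AbelianVariety.isSmoothProjective_holds (A := A)) 1) hn1 heff ψ hφE hd hφ2 hE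
      hμ h22 eQ q' hΘ hΘq hYφ hYskew hYsu u
    rw [← haEq, hslice_e] at hL
    have hYG : ∀ _t : Fin (2 * p), LinearMap.toMatrix eC eC Y * G = G * LinearMap.toMatrix cbσ cbσ Y :=
      fun _ => by rw [hG, linearMap_toMatrix_mul_basis_toMatrix, basis_toMatrix_mul_linearMap_toMatrix]
    have hblk : LinearMap.toMatrix cbσ cbσ Y = blockLiftGen φι Nf := by
      rw [hYdef, LinearMap.toMatrix_toLin]
    have h3 : wordRepAt ℂ (fun _ : Fin (2 * p) => G)
        (wordDerAt ℂ (fun _ : Fin (2 * p) => blockLiftGen φι Nf) (wordSlice ax u)) = 0 := by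
      rw [← hblk, wordRepAt_wordDerAt_of_mul_eq ℂ (fun _ : Fin (2 * p) => G) hYG, hL]
    exact wordRepAt_injective ℂ (g := fun _ : Fin (2 * p) => G) (g' := fun _ : Fin (2 * p) => G')
      (funext fun _ => hG'G) (by rw [h3, map_zero])
  -- the coefficient function, refined to slot-and-type colours
  refine ⟨placeRefineGen φι ax, ?_, fun U X => ?_⟩
  · rw [← hcax]
    have hx : (fun x : (Fin n × Fin 2) × Fin n₀ => avLetters g v (x.1.1, φι.symm (x.1.2, x.2))) =
        fun x => avLetters g (fun tl : Fin 2 × Fin n₀ =>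
          ofRatClassBaseChange (Motives.ComplexPoints A.X) 1 (cb tl)) (x.1.1, (x.1.2, x.2)) := by
      funext x
      rw [avLetters_apply, avLetters_apply, hv_apply, Equiv.apply_symm_apply]
    rw [← hx]
    exact wordEval_placeRefineGen F φι (avLetters g v) ax
  · intro hXtr
    exact wordDerAt_placeRefineGen_eq_zero φι (fun t : Fin 2 => if t = 0 then X else -Xᵀ) (key X hXtr) U

end Invariance

/-! ### §2 The group form: the slices are `SL_{n₀}(ℂ)`-invariants -/

section Group

variable {A B : AbelianVariety ℂ} {n : ℕ} {g : Fin n → (B ⟶ A)}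

open scoped Classical in
/-- **The invariance theorem at `(2,2)`, GROUP form.** In the setting of `AVSlots.exists_unitaryInvariant_coeff_twoTwo`,
every rational `(p,p)`-class on `B` is `∑_w a(w)·(g e, g f)_w` for a coefficient function `a` whose slices are FIXED by
the typed Kronecker action of every `M ∈ SL_{n₀}(ℂ)` — `M` at the `W`-letters, `(M⁻¹)ᵀ` at the `W'`-letters, the
tree's `mixedGrpFamily` with types `t ↦ ((U t).2 = 0)` — (Lie form + `SL_{n₀}` is generated by unipotents and its
determinant-one torus: `ClassicalInvariants.wordRepAt_mixedGrpFamily_eq_self_of_forall_trace_of_det_eq_one`,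
Goodman–Wallach Thm. 2.2.2 and Thm. 2.2.7 (2)). This is the input of the tensor first fundamental theorem for
`SL₄ = SU(2,2)_ℂ` (van Geemen Thm. 6.12: contractions and determinants, i.e. divisor classes and Weil classes).
[cite: MoonenZarhin1995Duke, main theorem (type IV(1,1), (2,2))] [cite: vanGeemen1994HodgeAV, Thm. 6.11 and Thm. 6.12]
[cite: GoodmanWallachGTM255, Thm. 2.2.2 and Thm. 2.2.7 (2)] [cite: MoonenZarhin1999LowDim, §2 (2.5) (2)] -/
theorem AVSlots.exists_slInvariant_coeff_twoTwo [HodgeTensorFacts.{0, 0}] (hg : AVSlots A B g)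
    (hHD : exists_isReal_hodgeModel) (hI : hodgePQ_independent_of_hodgeModel)
    (ψ : (BettiUniverse.hodge hHD (AbelianVariety.isSmoothProjective_holds (A := A)) 1).Polarization)
    {φ : Module.End ℚ (bettiCohomology A.X 1)}
    (hφE : φ ∈ (BettiUniverse.hodge hHD (AbelianVariety.isSmoothProjective_holds (A := A)) 1).endAlg)
    {d : ℚ} (hd : 0 < d) (hφ2 : φ * φ = -(d • 1))
    (hE : ∀ a ∈ (BettiUniverse.hodge hHD (AbelianVariety.isSmoothProjective_holds (A := A)) 1).endAlg,
      ∃ x y : ℚ, a = x • 1 + y • φ)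
    {μ : ℂ} (hμ : μ ^ 2 = -(d : ℂ))
    (h22 : Module.finrank ℂ ↥(Module.End.eigenspace (φ.baseChange ℂ) μ ⊓
        (BettiUniverse.hodge hHD (AbelianVariety.isSmoothProjective_holds (A := A)) 1).piece 1 0) = 2 ∧
      Module.finrank ℂ ↥(Module.End.eigenspace (φ.baseChange ℂ) μ ⊓
        (BettiUniverse.hodge hHD (AbelianVariety.isSmoothProjective_holds (A := A)) 1).piece 0 1) = 2)
    {n₀ : ℕ} (cb : Module.Basis (Fin 2 × Fin n₀) ℂ (ℂ ⊗[ℚ] bettiCohomology A.X 1)) (κ : Fin n₀ → Fin 2)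
    (hcbW : ∀ ℓ, cb (0, ℓ) ∈ Module.End.eigenspace (φ.baseChange ℂ) μ)
    (hcbW' : ∀ ℓ, cb (1, ℓ) ∈ Module.End.eigenspace (φ.baseChange ℂ) (-μ))
    (hcb0 : ∀ ℓ, κ ℓ = 0 →
      cb (0, ℓ) ∈ (BettiUniverse.hodge hHD (AbelianVariety.isSmoothProjective_holds (A := A)) 1).piece 1 0 ∧
      cb (1, ℓ) ∈ (BettiUniverse.hodge hHD (AbelianVariety.isSmoothProjective_holds (A := A)) 1).piece 0 1)
    (hcb1 : ∀ ℓ, κ ℓ = 1 →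
      cb (0, ℓ) ∈ (BettiUniverse.hodge hHD (AbelianVariety.isSmoothProjective_holds (A := A)) 1).piece 0 1 ∧
      cb (1, ℓ) ∈ (BettiUniverse.hodge hHD (AbelianVariety.isSmoothProjective_holds (A := A)) 1).piece 1 0)
    (hdual : ∀ i j, ψ.form.baseChange ℂ (cb (0, i)) (cb (1, j)) = if i = j then 1 else 0)
    {p : ℕ} (hp : 0 < p) {c : complexBetti B.X (2 * p)} (hcQ : IsRationalClass c)
    (hc : IsOfHodgeType B.dim B.X (2 * p) p p c) :
    ∃ a : (Fin (2 * p) → (Fin n × Fin 2) × Fin n₀) → ℂ,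
      wordEval (cupPowOneAlt ℂ (Motives.ComplexPoints B.X) (2 * p))
        (fun x : (Fin n × Fin 2) × Fin n₀ => avLetters g (fun tl : Fin 2 × Fin n₀ =>
          ofRatClassBaseChange (Motives.ComplexPoints A.X) 1 (cb tl)) (x.1.1, (x.1.2, x.2))) a = c ∧
      ∀ (U : Fin (2 * p) → Fin n × Fin 2) (M : Matrix (Fin n₀) (Fin n₀) ℂ), M.det = 1 →
        wordRepAt ℂ (mixedGrpFamily (fun t => decide ((U t).2 = 0)) M) (wordSlice a U) = wordSlice a U := by
  obtain ⟨a, hca, hkill⟩ := hg.exists_unitaryInvariant_coeff_twoTwo hHD hI ψ hφE hd hφ2 hE hμ h22 cb κ hcbW hcbW'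
    hcb0 hcb1 hdual hp hcQ hc
  refine ⟨a, hca, fun U M hM => ?_⟩
  refine wordRepAt_mixedGrpFamily_eq_self_of_forall_trace_of_det_eq_one (fun t => decide ((U t).2 = 0))
    (fun X hX => ?_) hM
  have hfam : mixedLieFamily (fun t => decide ((U t).2 = 0)) X = fun t => if (U t).2 = 0 then X else -Xᵀ := by
    funext t
    simp only [mixedLieFamily, decide_eq_true_eq]
  rw [hfam]
  exact hkill U X hX

end Group

end Literature.AlgebraicGeometry.HodgeTheory

end
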